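import Summits.BirchSwinnertonDyer.BirchSwinnertonDyer.Theorems.ByReductionTypeAtTwoOrdKatoHalfAtTwoIsoConjATwoOfPointFieldMu
import Summits.BirchSwinnertonDyer.BirchSwinnertonDyer.Theorems.AlignedTransportAtTwoMainConjectureOfRankZeroBSDAtTwoTorsionPointFieldDegree
import Summits.BirchSwinnertonDyer.BirchSwinnertonDyer.Theorems.ByReductionTypeAtTwoFineSelmerConjAAtTwoAdditivePotGoodCubicRealization
import Literature.NumberTheory.IwasawaTheory.ClassicalMuVanishesAdjoinIOfNarrow
import Literature.NumberTheory.EllipticCurves.NonEisensteinPrimeOfSurjective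
import HarnessLib

/-!
# Route `ByReductionTypeAtTwo`, crux `OrdKatoHalfAtTwoIso` (stmt-BirchSwinnertonDyer-19573), the `0 < Δ` cell: Coates–Sujatha's (A) at `2`
# — the Q⁺ text `FineSelmerConjATwoOrdPosDisc` (registered stub `stub_conjA_two_posDisc` of v14–v23; under v24 an input below the registered
# G11⁺ `stub_greenbergMu_two_posDisc`) — from «NARROW μ₂ = 0» of the cubic point field `ℚ(P)` (KERNEL; Kida-lite at `ℓ = 2`)

`--supports stmt-BirchSwinnertonDyer-19573` file of the width seat `cruxlead-stmt-BirchSwinnertonDyer-19573-w2` GEN 8 (cell `bsd-2adic`). THEOREMS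
ONLY (no definition, no named fact, no `sorry`). Closes nothing: Q⁺ and every `μ₂ = 0` input below remain OPEN as `∀`-statements; BSD is not
proved by any of this.

WHAT. w2 GEN 6's KERNEL sextic door (`PointFieldMu.exists_fineSelmerDualData_moduleFinite_of_classicalMu_pointField_adjoin`, p718233) gives
(A) at `(W, 2)` from Iwasawa's `μ₂ = 0` for the cyclotomic `ℤ₂`-extensions of the totally complex SEXTIC carrier `ℚ(P, √−1)`. On the `0 < Δ`
cell the point field `ℚ(P)` is a TOTALLY REAL cubic, where GEN 7's unit-signature ascent (`classicalMu_of_sq_eq_of_odd_finrank`, ≤ 1 real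
place) does not apply (`SCOPE-LIM2-DOWN-w2g7` §3a). The Literature module «Kida-lite at `ℓ = 2`» of this seat
(`ClassicalMuVanishesQuadraticAscentNarrowRat.classicalMu_of_sq_eq_of_odd_finrank_of_narrowDefect_le`: Chevalley at `2` with the NARROW class
number + the cyclic rank bound + «bounded ranks ⟺ μ = 0») ascends `μ₂ = 0` from ANY odd-degree `K` to `K(√m)` totally complex as soon as
(a) `μ₂(K) = 0` AND (b) the narrow defect `ord₂ h⁺(K_n) − ord₂ h(K_n)` is BOUNDED along the cyclotomic `ℤ₂`-tower of `K` — (a) ∧ (b) being the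
numerical form of «the NARROW unramified Iwasawa module of `K_∞/K` has `μ = 0`» (Kida 1982 reduces `μ₂(k⁺(√−1))` to exactly this). Hence:

* §1 `classicalMu_pointField_adjoin_I_of_narrowDefect_le` — for `W/ℚ` elliptic, `P ∈ W[2] ∖ 0` with `[ℚ(P) : ℚ]` odd, `i² = −1`:
  (a) ∧ (b) for `ℚ(P) = ℚ̄^{Stab P}` ⟹ `μ₂ = 0` for every cyclotomic `ℤ₂`-extension of `ℚ(P) ⊔ ℚ⟮i⟯` (generator `x = i`, `m = −1`).
* §2 **`conjA_two_of_narrowMu_pointField`** — (a) ∧ (b) for an odd-degree point field `ℚ(P)` ⟹ (A) at `(W, 2)` (`∃ γ D` form), ANY sign of `Δ`.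
* §3 **`fineSelmerConjATwoOrdPosDisc_of_narrowMu_pointField`** — the Q⁺ ROAD of the line `steinberg-fibre-at-two`: on the cell [non-CM, `r_an = 0`,
  good ordinary at `2`, `ρ̄₂` onto, `0 < Δ`], (a) ∧ (b) for SOME `P ≠ 0` at every curve ⟹ `FineSelmerConjATwoOrdPosDisc` (Q⁺; a registered stub up to
  v23, since v24 the (A)₂-half of the registered G11⁺ `stub_greenbergMu_two_posDisc` — Q⁺ is NECESSARY for the crux, lead g6 p702303). This is crux-triage
  r1-2's «first honest rung: μ₂*-NARROW(ℚ(P)^cyc) = 0 (Kida) ⟹ Iw₆⁺ ⟹ Q⁺» as a KERNEL implication (previously displayed only as the sextic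
  hypothesis `conjA_two_posDisc_of_classicalMu_pointField`). The input is Greenberg-conjecture territory for the totally real `S₃`-cubics `ℚ(P)`;
  nothing is asserted about it.
* §4 **`conjA_two_cubicModel_of_narrowMu`** — the CUBIC-MODEL door for the census currency of C1″/k4 (`y² = x³ + px² + qx + r`, `p q r ∈ ℤ`,
  irreducible cubic, `β` a root): (a) ∧ (b) for `ℚ(β)` ⟹ (A)₂, ANY sign of the discriminant (on `disc < 0` GEN 7's
  `conjA_two_cubicModel_of_classicalMu_of_discr_neg` needs (a) alone). Dischargeable today where `h⁺(ℚ(β)·ℚ_n)` is controlled for all `n`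
  (one prime above `2` with `h⁺(ℚ(β))` odd — the rows k4-w2's `…GenusDoorSignature` already reaches); for the split-`2` totally real rows it
  prices the missing input as a NARROW Fukuda-type certificate.

References: [CoatesSujatha2005] Conj. A, Thm. 3.4; [Lim2017FineSelmer] §3 Thm. 3.5 / Lemma 3.2; [Kida1982JFields] Y. Kida, J. Number Theory 14
(1982) 340–352 (shape); [Iwasawa1973MuInvariants] Thm. 2/3; [Washington1997] §13.3 Prop. 13.23; tree p718233, p725014, and this seat's
`AmbiguousClassNumberNarrowInequality` / `ClassicalMuVanishesQuadraticAscentNarrow{,Rat}`.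
-/

set_option autoImplicit false
-- sibling precedent (`…ConjATwoOfPointFieldMu.lean`): the directory name repeats the summit name
set_option linter.dupNamespace false

noncomputable section

open scoped Classical NumberField IntermediateField Polynomial

namespace Summit.BirchSwinnertonDyer.BirchSwinnertonDyer.Theorems.SteinbergFibreAtTwo.NarrowMu

open WeierstrassCurve NumberField IsDedekindDomain Field Polynomial
open Literature.NumberTheory.EllipticCurves Literature.NumberTheory.EllipticCurves.ZpExtension
  Literature.NumberTheory.GaloisRepresentations Literature.NumberTheory.IwasawaTheory Literature.NumberTheory.NumberFields
  Literature.NumberTheory.EllipticCurves.Rank1Residual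
open Summit.BirchSwinnertonDyer.BirchSwinnertonDyer.Theorems.AlignedTransportAtTwoTorsionPointField
open Summit.BirchSwinnertonDyer.BirchSwinnertonDyer.Theorems.SteinbergFibreAtTwo
open Summit.BirchSwinnertonDyer.BirchSwinnertonDyer.Theses.ByReductionTypeAtTwo

/-! ## §1 `μ₂ = 0` for the sextic carrier `ℚ(P, √−1)` from NARROW `μ₂ = 0` of the odd-degree point field `ℚ(P)` -/

section PointField

variable (W : WeierstrassCurve ℚ) [W.IsElliptic]

/-- **Narrow `μ₂(ℚ(P)) = 0` ⟹ `μ₂(ℚ(P, √−1)) = 0`** (`W/ℚ` elliptic, `P ∈ W[2]` with `[ℚ(P) : ℚ]` ODD, `ℚ(P) = ℚ̄^{Stab P}`, `i² = −1`): if every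
cyclotomic `ℤ₂`-extension `κP` of `ℚ(P)` has (a) `ClassicalMuVanishes κP` and (b) `ord₂ h⁺(ℚ(P)_n) ≤ ord₂ h(ℚ(P)_n) + D` along its layers (stated for ANY `NumberField` instance on the layer, so that it
rewrites along equalities of point fields), then every cyclotomic `ℤ₂`-extension of the totally complex field `ℚ(P) ⊔ ℚ⟮i⟯` has `μ = 0` — the Literature theorem
`classicalMu_sup_adjoin_of_sq_eq_neg_one_of_narrowDefect_le` (Kida-lite with `x = i`, `m = −1`) at `K = ℚ(P)`, finite over `ℚ`. [cite: Kida1982JFields, main theorem (μ-part; shape only)]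
[cite: Iwasawa1973MuInvariants, Thm. 2 and Thm. 3] [cite: Washington1997, §13.3 Prop. 13.23] -/
theorem classicalMu_pointField_adjoin_I_of_narrowDefect_le {P : geomTorsion W 2}
    (hodd : Odd (Module.finrank ℚ ↥(IntermediateField.fixedField (MulAction.stabilizer (absoluteGaloisGroup ℚ) P))))
    {i : AlgebraicClosure ℚ} (hi : i ^ 2 = -1)
    (hμ : ∀ κP : ZpExtension ↥(IntermediateField.fixedField (MulAction.stabilizer (absoluteGaloisGroup ℚ) P)) 2,
      κP.IsCyclotomic → ClassicalMuVanishes κP) (D : ℕ)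
    (hδ : ∀ κP : ZpExtension ↥(IntermediateField.fixedField (MulAction.stabilizer (absoluteGaloisGroup ℚ) P)) 2,
      κP.IsCyclotomic → ∀ n : ℕ,
      ∀ [NumberField ↥(κP.layer n)],
      padicValNat 2 (narrowClassNumber ↥(κP.layer n)) ≤ padicValNat 2 (classNumber ↥(κP.layer n)) + D) :
    ∀ κF : ZpExtension ↥(IntermediateField.fixedField (MulAction.stabilizer (absoluteGaloisGroup ℚ) P) ⊔
        IntermediateField.adjoin ℚ ({i} : Set (AlgebraicClosure ℚ))) 2, κF.IsCyclotomic → ClassicalMuVanishes κF := by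
  haveI : FiniteDimensional ℚ ↥(IntermediateField.fixedField (MulAction.stabilizer (absoluteGaloisGroup ℚ) P)) :=
    finiteDimensional_fixedField_stabilizer W P
  exact classicalMu_sup_adjoin_of_sq_eq_neg_one_of_narrowDefect_le _ hodd hi hμ D hδ

/-! ## §2 Statement (A) at `(W, 2)` from narrow `μ₂ = 0` of an odd-degree point field — ANY sign of `Δ` -/

/-- **(A) at `(W, 2)` from NARROW `μ₂ = 0` of the point field `ℚ(P)`** (`W/ℚ` elliptic, `P ∈ W[2] ∖ 0` with `[ℚ(P) : ℚ]` odd — e.g. `3`, the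
irreducible case): hypotheses (a) `μ₂ = 0` for every cyclotomic `ℤ₂`-extension of `ℚ(P) = ℚ̄^{Stab P}` and (b) bounded narrow defect
`ord₂ h⁺(ℚ(P)_n) ≤ ord₂ h(ℚ(P)_n) + D` along its layers; conclusion: for every cyclotomic `ℤ₂`-extension `κ` of `ℚ` some `FineSelmerDualData` of
`W` has `X` finitely generated over `ℤ₂`. §1 + w2 GEN 6's KERNEL sextic door (carrier `ℚ(P) ⊔ ℚ⟮√−1⟯`, unipotent dévissage + Lim 3.5 at `2`
upstairs `_holds`). No sign condition on `Δ`: for `Δ < 0` GEN 7's doors need (a) only; for `0 < Δ` (totally real `ℚ(P)`) this is the first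
kernel road from data of `ℚ(P)` itself. [cite: CoatesSujatha2005, Conj. A and Thm. 3.4] [cite: Lim2017FineSelmer, §3 Thm. 3.5 and Lemma 3.2]
[cite: Kida1982JFields, main theorem (μ-part; shape only)] -/
theorem conjA_two_of_narrowMu_pointField {P : geomTorsion W 2} (hP : P ≠ 0)
    (hodd : Odd (Module.finrank ℚ ↥(IntermediateField.fixedField (MulAction.stabilizer (absoluteGaloisGroup ℚ) P))))
    (hμ : ∀ κP : ZpExtension ↥(IntermediateField.fixedField (MulAction.stabilizer (absoluteGaloisGroup ℚ) P)) 2,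
      κP.IsCyclotomic → ClassicalMuVanishes κP) (D : ℕ)
    (hδ : ∀ κP : ZpExtension ↥(IntermediateField.fixedField (MulAction.stabilizer (absoluteGaloisGroup ℚ) P)) 2,
      κP.IsCyclotomic → ∀ n : ℕ,
      ∀ [NumberField ↥(κP.layer n)],
      padicValNat 2 (narrowClassNumber ↥(κP.layer n)) ≤ padicValNat 2 (classNumber ↥(κP.layer n)) + D)
    (κ : ZpExtension ℚ 2) (hκ : κ.IsCyclotomic) :
    ∃ (γ : absoluteGaloisGroup ℚ) (Dd : W.FineSelmerDualData κ γ),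
      Module.Finite ℤ_[2] (RestrictScalars ℤ_[2] (IwasawaAlgebra 2) Dd.X) := by
  obtain ⟨i, hi⟩ := IsAlgClosed.exists_pow_nat_eq (-1 : AlgebraicClosure ℚ) two_pos
  exact PointFieldMu.exists_fineSelmerDualData_moduleFinite_of_classicalMu_pointField_adjoin W hP hi
    (classicalMu_pointField_adjoin_I_of_narrowDefect_le W hodd hi hμ D hδ) κ hκ

end PointField

/-! ## §3 The Q⁺ road of the line `steinberg-fibre-at-two`: `FineSelmerConjATwoOrdPosDisc` ⟸ narrow `μ₂(ℚ(P)) = 0` on the `0 < Δ` cell -/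

/-- **ROAD INTO Q⁺ `FineSelmerConjATwoOrdPosDisc` (`stub_conjA_two_posDisc` of v14–v23) FROM NARROW `μ₂ = 0` OF THE TOTALLY REAL CUBIC `ℚ(P)` — KERNEL.** If at every curve of the cell
[non-CM, analytic rank `0`, good ordinary at `2`, `ρ̄_{W,2}` onto, `0 < Δ`] SOME non-zero `P ∈ W[2]` has (a) `μ₂ = 0` for every cyclotomic
`ℤ₂`-extension of `ℚ(P) = ℚ̄^{Stab P}` (an `S₃`-cubic, here totally real) and (b) a bounded narrow defect `ord₂ h⁺(ℚ(P)_n) ≤ ord₂ h(ℚ(P)_n) + D`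
along its layers, then `FineSelmerConjATwoOrdPosDisc` (Coates–Sujatha's (A) at `2` on the cell). (a) ∧ (b) = «`μ = 0` for the NARROW Iwasawa
module of `ℚ(P)_∞/ℚ(P)`» in numerical form — crux-triage r1-2's «first honest rung μ₂*-NARROW(ℚ(P)^cyc) = 0 (Kida) ⟹ Iw₆⁺ ⟹ Q⁺», now a kernel
implication; Greenberg-conjecture territory for a non-abelian totally real family — OPEN, nothing asserted. `[ℚ(P) : ℚ] = 3` from `ρ̄₂` onto
(`finrank_fixedField_stabilizer_eq_three_of_irreducible`). [cite: CoatesSujatha2005, Conj. A] [cite: Lim2017FineSelmer, §3 Thm. 3.5 and Lemma 3.2]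
[cite: Kida1982JFields, main theorem (μ-part; shape only)] [cite: Iwasawa1973MuInvariants, §1 (shape only)] -/
theorem fineSelmerConjATwoOrdPosDisc_of_narrowMu_pointField
    (hIw : ∀ (W : WeierstrassCurve ℚ) [W.IsElliptic] [W.IsGloballyMinimal], ¬ W.HasCM → W.analyticRank = 0 →
      GoodOrd W 2 → W.HasSurjectiveModNGaloisRep 2 → 0 < W.Δ →
      ∃ (P : geomTorsion W 2) (D : ℕ), P ≠ 0 ∧
        (∀ κP : ZpExtension ↥(IntermediateField.fixedField (MulAction.stabilizer (absoluteGaloisGroup ℚ) P)) 2,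
          κP.IsCyclotomic → ClassicalMuVanishes κP) ∧
        (∀ κP : ZpExtension ↥(IntermediateField.fixedField (MulAction.stabilizer (absoluteGaloisGroup ℚ) P)) 2,
          κP.IsCyclotomic → ∀ n : ℕ,
          ∀ [NumberField ↥(κP.layer n)],
          padicValNat 2 (narrowClassNumber ↥(κP.layer n)) ≤ padicValNat 2 (classNumber ↥(κP.layer n)) + D)) :
    FineSelmerConjATwoOrdPosDisc := by
  intro W _ _ hcm hr hgo h2 hΔ κ hκ
  obtain ⟨P, D, hP, hμ, hδ⟩ := hIw W hcm hr hgo h2 hΔ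
  have h3 : Module.finrank ℚ ↥(IntermediateField.fixedField (MulAction.stabilizer (absoluteGaloisGroup ℚ) P)) = 3 :=
    finrank_fixedField_stabilizer_eq_three_of_irreducible W (hasIrreducibleModPGaloisRep_of_hasSurjectiveModNGaloisRep W 2 h2) hP
  exact conjA_two_of_narrowMu_pointField W hP (by rw [h3]; decide) hμ D hδ κ hκ

/-! ## §4 The cubic-model door (census currency of C1″ / k4: `y² = x³ + px² + qx + r`, `β` a root) -/

/-- **(A) at `2` for `y² = x³ + px² + qx + r` (`p, q, r ∈ ℤ`, IRREDUCIBLE cubic, `β ∈ ℚ̄` a root) from NARROW `μ₂ = 0` of the cubic field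
`ℚ(β)`** — ANY sign of the discriminant: if every cyclotomic `ℤ₂`-extension `κP` of `ℚ(β)` has (a) `μ = 0` and (b)
`ord₂ h⁺(ℚ(β)_n) ≤ ord₂ h(ℚ(β)_n) + D` along its layers, then for every cyclotomic `κ` some `FineSelmerDualData` of `⟨0, p, 0, q, r⟩` has `X`
finitely generated over `ℤ₂`. §2 at the `2`-torsion point `P_β = (β, 0)`, whose point field IS `ℚ(β)` (k4's
`AddKatoTwo.fixedField_stabilizer_eq_adjoin_root`), `[ℚ(β) : ℚ] = 3`. For `disc < 0` the (b)-free door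
`TotallyComplexMu.conjA_two_cubicModel_of_classicalMu_of_discr_neg` (GEN 7) is stronger; for `disc > 0` (three real places) this is the door.
[cite: CoatesSujatha2005, Conj. A and Thm. 3.4] [cite: Kida1982JFields, main theorem (μ-part; shape only)] [cite: SilvermanAEC2009, VIII.§1 (K(E[m]))] -/
theorem conjA_two_cubicModel_of_narrowMu (p q r : ℤ)
    [((⟨0, (p : ℚ), 0, (q : ℚ), (r : ℚ)⟩ : WeierstrassCurve ℚ)).IsElliptic]
    (hirr : Irreducible (Cubic.toPoly ⟨1, (p : ℚ), q, r⟩))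
    {β : AlgebraicClosure ℚ} (hβ : aeval β (Cubic.toPoly ⟨1, (p : ℚ), q, r⟩) = 0)
    (hμ : ∀ κP : ZpExtension ↥(IntermediateField.adjoin ℚ ({β} : Set (AlgebraicClosure ℚ))) 2,
      κP.IsCyclotomic → ClassicalMuVanishes κP) (D : ℕ)
    (hδ : ∀ κP : ZpExtension ↥(IntermediateField.adjoin ℚ ({β} : Set (AlgebraicClosure ℚ))) 2, κP.IsCyclotomic → ∀ n : ℕ,
      ∀ [NumberField ↥(κP.layer n)],
      padicValNat 2 (narrowClassNumber ↥(κP.layer n)) ≤ padicValNat 2 (classNumber ↥(κP.layer n)) + D)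
    (κ : ZpExtension ℚ 2) (hκ : κ.IsCyclotomic) :
    ∃ (γ : absoluteGaloisGroup ℚ) (Dd : ((⟨0, (p : ℚ), 0, (q : ℚ), (r : ℚ)⟩ : WeierstrassCurve ℚ)).FineSelmerDualData κ γ),
      Module.Finite ℤ_[2] (RestrictScalars ℤ_[2] (IwasawaAlgebra 2) Dd.X) := by
  set W : WeierstrassCurve ℚ := ⟨0, (p : ℚ), 0, (q : ℚ), (r : ℚ)⟩
  -- the `2`-torsion point `P_β = (β, 0)` and its point field `ℚ(β)`
  obtain ⟨P, hP, hPβ⟩ := AddKatoTwo.exists_geomTorsion_two_eq_some_root (p : ℚ) (q : ℚ) (r : ℚ) hβ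
  have hF : IntermediateField.fixedField (MulAction.stabilizer (absoluteGaloisGroup ℚ) P) =
      IntermediateField.adjoin ℚ ({β} : Set (AlgebraicClosure ℚ)) :=
    AddKatoTwo.fixedField_stabilizer_eq_adjoin_root (p : ℚ) (q : ℚ) (r : ℚ) hβ hPβ
  -- `[ℚ(β) : ℚ] = 3`
  have hmonic : (Cubic.toPoly ⟨1, (p : ℚ), q, r⟩).Monic := Cubic.monic_of_a_eq_one rfl
  have hβint : IsIntegral ℚ β := ⟨_, hmonic, by rwa [← aeval_def]⟩
  have h3 : Module.finrank ℚ ↥(IntermediateField.adjoin ℚ ({β} : Set (AlgebraicClosure ℚ))) = 3 := by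
    rw [IntermediateField.adjoin.finrank hβint, ← minpoly.eq_of_irreducible_of_monic hirr hβ hmonic]
    exact Cubic.natDegree_of_a_ne_zero' one_ne_zero
  have hodd' : Odd (Module.finrank ℚ ↥(IntermediateField.adjoin ℚ ({β} : Set (AlgebraicClosure ℚ)))) := by
    rw [h3]; decide
  have hodd : Odd (Module.finrank ℚ ↥(IntermediateField.fixedField (MulAction.stabilizer (absoluteGaloisGroup ℚ) P))) := by
    rw [hF]; exact hodd'
  -- transport (a) and (b) along `ℚ̄^{Stab P_β} = ℚ(β)`
  refine conjA_two_of_narrowMu_pointField W hP hodd ?_ D ?_ κ hκ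
  · rw [hF]; exact hμ
  · rw [hF]; exact hδ

end Summit.BirchSwinnertonDyer.BirchSwinnertonDyer.Theorems.SteinbergFibreAtTwo.NarrowMu

end
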